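import Mathlib
import Summits.NavierStokesRegularity.NavierStokesRegularity.Theorems.TaoLadderRungTwoFlatHopTubeWithGlue
import Summits.NavierStokesRegularity.NavierStokesRegularity.Theorems.TaoLadderRungTwoFlatHopTubeStatics
import Summits.NavierStokesRegularity.NavierStokesRegularity.Theorems.TaoLadderRungTwoFlatHopTubeLanding
import HarnessLib

/-!
# STATICS OF THE R54 TUBE (L-57d): `TameBehind` from the (B1) block-energy clause alone, and `TubeStaticsWith` for the
  parametric frame with the R54 behind conjunct discharged from the schedule (helper for the K_A♭ parent item
  stmt-NavierStokesRegularity-22987 `FlatGapCertificatesV2`, child 2A `GradedAdiabaticWakeA` of route TaoLadderRungTwoFlat;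
  cell harvest/h2-tao-ladder, p1 g23; theory-1 g45 numT57 §5 ask L-57d, LADDER §54 (R54-1), §57.5/57.8)

The parametric frame `…HopTubeWith` leaves the behind conjunct `Bcl` free; its static format clauses
(`TubeStaticsWith … = … ∧ TailFat ∧ TameBehind ∧ TailCompat` for `Z := tubeSetWith P Bcl …`) must be re-discharged for the R54
instance `Bcl := behindR54 P θ′ Wb` ((B1) `R54.BehindEnergyClause P.K θ′ (Wb n)` ∧ (B2) existential cap). The only clause that
reads the behind conjunct is `TameBehind` (uniform `|z_{ik}| ≤ C(1 + (1+ε₀)^{−k})` over the whole tube): behind the window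
(B1) gives `|z_{ik}| ≤ √(2·Wb n)·e^{θ′(−K−k)/2}` (`R54.abs_le_of_behindEnergyClause`), and for the SLOW exponent
`θ′ ≤ 2·log(1+ε₀)` (`θ_b′ ≤ 1`) this is `≤ √(2W̄)·(1+ε₀)^{−k}` — tame. Everything else is the tree's statics verbatim.

* `tailClause_of_inTubeWith` — the `TailFat` state clause ahead of `k₁` for ANY behind conjunct;
* `exp_slow_le_rpow` — `e^{θ′(−K−k)/2} ≤ (1+ε₀)^{−k}` for `k < −K`, `θ′ ≤ 2 log(1+ε₀)`;
* `abs_le_of_inTubeR54` — uniform tame bound of every R54 tube state, explicit in the schedule sups (`Wb n ≤ W̄`);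
* `tubeStaticsWith_R54_of_schedule` — `TubeStaticsWith P (behindR54 P θ′ Wb) …` from the weight algebra and the schedule sups;
* `tubeStaticsWith_R54_tubeWeight` — the same with the concrete Gaussian weight `tubeWeight C b` and envelope `tubeEnv`.

HONEST FRAMING: bookkeeping over the cell's typed induction frame (MODEL lattice, graded mirror table on `S♭`, `m = 2`);
nothing certified; no item closed; nothing about the Navier–Stokes equations.
-/

noncomputable section

-- the sub-problem namespace repeats the summit name by design (D-0017)
set_option linter.dupNamespace false

namespace Summit.NavierStokesRegularity.NavierStokesRegularity.Theorems.HopTube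

open Set Finset Literature.Analysis.FluidPDE Literature.Analysis.FluidPDE.TaoCascade

section StaticsWith

variable (P : TubeSchedule) {Bcl : ℕ → (Fin 2 → ℤ → ℝ) → Prop} {ε₀ : ℝ} {i₀ : Fin 2} {X₀ : Fin 2 → ℝ} {w : ℤ → ℝ}
  {r : ℝ} {ζ : ℕ → Fin 2 → ℤ → ℝ} {ustar : Fin 2 → ℤ → ℝ}

/-- Ahead of shell `k₁ ≥ 1` every state of the parametric tube satisfies the `TailFat` state clause `4·w_k|z_k| ≤ r`, for
ANY behind conjunct. [cite: Tao2016AveragedNS, §6.2 Prop. 6.3 (ix); cell LADDER §50, §57.5] -/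
theorem tailClause_of_inTubeWith (hk₁ : 1 ≤ P.k₁) (hw : ∀ k, 0 ≤ w k) (hr : 0 ≤ r) {n : ℕ} {z : Fin 2 → ℤ → ℝ}
    (hz : InTubeWith P Bcl i₀ X₀ w r ζ ustar n z) {k : ℤ} (hk : (P.k₁ : ℤ) ≤ k) (i : Fin 2) :
    4 * (w k * |z i k|) ≤ r := by
  have hAhead : ∀ {z : Fin 2 → ℤ → ℝ}, AheadClause P w r z → 4 * (w k * |z i k|) ≤ r := by
    intro z h
    have h8 := h i k hk
    have h0 : 0 ≤ w k * |z i k| := mul_nonneg (hw k) (abs_nonneg _)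
    linarith
  by_cases h0 : n = 0
  · simp only [InTubeWith, h0, if_true] at hz
    subst hz
    have hk0 : k ≠ 0 := by omega
    simp [datumState, hk0, hr]
  by_cases h1 : n ≤ P.N₀
  · simp only [InTubeWith, h0, if_false, if_pos h1] at hz
    exact hAhead hz.2
  · simp only [InTubeWith, h0, if_false, if_neg h1] at hz
    exact hAhead hz.2.2.2.2

end StaticsWith

/-- **The slow behind weight is tame**: for `k < −K`, `0 ≤ θ′ ≤ 2·log(1+ε₀)` (`0 ≤ ε₀`):
`e^{θ′(−K−k)/2} ≤ (1+ε₀)^{−k}` (no sign condition on `θ′` is needed). [cite: Tao2016AveragedNS, §6.2 Prop. 6.3 (statement shape of the tameness clause); cell LADDER §54 (R54-1, θ′ = 2θ_b′ log(1+ε₀), θ_b′ ≤ 1), §57.5 (L-57d)] -/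
theorem exp_slow_le_rpow {ε₀ θ' : ℝ} (hε : 0 ≤ ε₀) (hθ2 : θ' ≤ 2 * Real.log (1 + ε₀)) {K : ℕ} {k : ℤ}
    (hk : k < -(K : ℤ)) : Real.exp (θ' * (-(K : ℝ) - k) / 2) ≤ (1 + ε₀) ^ (-(k : ℝ)) := by
  have hℓ : 0 ≤ Real.log (1 + ε₀) := Real.log_nonneg (by linarith)
  rw [Real.rpow_def_of_pos (by linarith : (0 : ℝ) < 1 + ε₀), Real.exp_le_exp]
  have hkR : (k : ℝ) < -(K : ℝ) := by exact_mod_cast hk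
  have hK : (0 : ℝ) ≤ K := Nat.cast_nonneg K
  have h1 : θ' * (-(K : ℝ) - k) ≤ 2 * Real.log (1 + ε₀) * (-(K : ℝ) - k) :=
    mul_le_mul_of_nonneg_right hθ2 (by linarith)
  nlinarith [mul_nonneg hℓ hK]

section R54Statics

variable (P : TubeSchedule) {θ' : ℝ} {Wb : ℕ → ℝ} {ε₀ : ℝ} {i₀ : Fin 2} {X₀ : Fin 2 → ℝ} {w : ℤ → ℝ}
  {r : ℝ} {ζ : ℕ → Fin 2 → ℤ → ℝ} {ustar : Fin 2 → ℤ → ℝ}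

/-- **Uniform tame bound of every R54 tube state** (L-57d): `|z i k| ≤ B₀·(1 + (1+ε₀)^{−k})` with `B₀` explicit in the
schedule sups — datum, capture, window, and `√(2W̄)` from the (B1) block-energy clause with the slow exponent
`θ′ ≤ 2 log(1+ε₀)`. [cite: Tao2016AveragedNS, §6.2 Prop. 6.3, §6.3–6.4 (statement shape); cell LADDER §54 (R54-1), §57.5 (L-57d)] -/
theorem abs_le_of_inTubeR54 (hg : 1 ≤ P.g) (hb : 1 ≤ P.b) (hAstar : 0 < P.Astar) (hε : 0 ≤ ε₀)
    (hθ2 : θ' ≤ 2 * Real.log (1 + ε₀))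
    {Wbar δbar ηbar Mζ Mu : ℝ} (hWb : ∀ n, 0 ≤ Wb n ∧ Wb n ≤ Wbar) (hδ : ∀ n, P.δ n ≤ δbar) (hδ0 : 0 ≤ δbar)
    (hη : ∀ n, P.η n ≤ ηbar) (hη0 : 0 ≤ ηbar) (hζ : ∀ n i k, |ζ n i k| ≤ Mζ)
    (hu : ∀ i k, -(P.K : ℤ) ≤ k → |ustar i k| ≤ Mu) (hMu : 0 ≤ Mu)
    {n : ℕ} {z : Fin 2 → ℤ → ℝ} (hz : InTubeWith P (behindR54 P θ' Wb) i₀ X₀ w r ζ ustar n z) (i : Fin 2) (k : ℤ) :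
    |z i k| ≤ ((|X₀ 0| + |X₀ 1|) / |X₀ i₀| + (Mζ + ηbar) + (Mu + δbar * P.b ^ P.K) + Real.sqrt (2 * Wbar)) *
      (1 + (1 + ε₀) ^ (-(k : ℝ))) := by
  set B₀ := (|X₀ 0| + |X₀ 1|) / |X₀ i₀| + (Mζ + ηbar) + (Mu + δbar * P.b ^ P.K) + Real.sqrt (2 * Wbar) with hB₀
  have hMζ : 0 ≤ Mζ := (abs_nonneg _).trans (hζ 0 0 0)
  have hWbar : 0 ≤ Wbar := (hWb 0).1.trans (hWb 0).2
  have hsq : 0 ≤ Real.sqrt (2 * Wbar) := Real.sqrt_nonneg _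
  have hCd : 0 ≤ (|X₀ 0| + |X₀ 1|) / |X₀ i₀| := by positivity
  have hbK : 0 ≤ δbar * P.b ^ P.K := mul_nonneg hδ0 (pow_nonneg (by linarith) _)
  have hpow : 0 < (1 + ε₀) ^ (-(k : ℝ)) := Real.rpow_pos_of_pos (by linarith) _
  have hB₀0 : 0 ≤ B₀ := by rw [hB₀]; linarith
  have key : ∀ T : ℝ, |z i k| ≤ T → T ≤ B₀ → |z i k| ≤ B₀ * (1 + (1 + ε₀) ^ (-(k : ℝ))) := by
    intro T h1 h2
    have : B₀ ≤ B₀ * (1 + (1 + ε₀) ^ (-(k : ℝ))) := by nlinarith [mul_nonneg hB₀0 hpow.le]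
    linarith
  by_cases h0 : n = 0
  · simp only [InTubeWith, h0, if_true] at hz
    subst hz
    refine key ((|X₀ 0| + |X₀ 1|) / |X₀ i₀|) ?_ (by rw [hB₀]; linarith)
    simp only [datumState]
    rw [abs_div, abs_abs]
    refine div_le_div_of_nonneg_right ?_ (abs_nonneg _)
    fin_cases i <;> split_ifs <;> simp <;> positivity
  by_cases h1 : n ≤ P.N₀
  · simp only [InTubeWith, h0, if_false, if_pos h1] at hz
    refine key (Mζ + ηbar) ?_ (by rw [hB₀]; linarith)
    have h2 := hz.1 i k
    have h3 := hζ n i k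
    have h4 := abs_sub_abs_le_abs_sub (z i k) (ζ n i k)
    linarith [hη n]
  · simp only [InTubeWith, h0, if_false, if_neg h1] at hz
    obtain ⟨hanch, hcore, -, hbehind, -⟩ := hz
    have hx0 : 0 ≤ anchorScale P i₀ z := by unfold anchorScale; positivity
    have hx1 : anchorScale P i₀ z ≤ 1 := by
      unfold anchorScale; rw [div_le_one hAstar]; exact hanch.2
    by_cases hk : k < -(P.K : ℤ)
    · -- behind the window: (B1) extraction with the slow exponent ≤ √(2W̄)·(1+ε₀)^{-k}
      have h6 := R54.abs_le_of_behindEnergyClause (hWb n).1 hbehind.1 i hk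
      have h5 := exp_slow_le_rpow (K := P.K) hε hθ2 hk
      have hsqn : Real.sqrt (2 * Wb n) ≤ Real.sqrt (2 * Wbar) :=
        Real.sqrt_le_sqrt (by linarith [(hWb n).2])
      have h7 : Real.sqrt (2 * Wb n) * Real.exp (θ' * (-(P.K : ℝ) - k) / 2)
          ≤ Real.sqrt (2 * Wbar) * (1 + ε₀) ^ (-(k : ℝ)) :=
        mul_le_mul hsqn h5 (Real.exp_pos _).le hsq
      have hAB : Real.sqrt (2 * Wbar) ≤ B₀ := by rw [hB₀]; linarith
      have h8 : Real.sqrt (2 * Wbar) * (1 + ε₀) ^ (-(k : ℝ)) ≤ B₀ * (1 + (1 + ε₀) ^ (-(k : ℝ))) := by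
        nlinarith [mul_le_mul_of_nonneg_right hAB hpow.le]
      linarith
    · rw [not_lt] at hk
      refine key (Mu + δbar * P.b ^ P.K) ?_ (by rw [hB₀]; linarith)
      have hG := HopInvariant.geomGauge_lower hg hb P.K i hk
      have hc := hcore i k hk
      have hbK' : 0 < P.b ^ P.K := pow_pos (by linarith) _
      have hδ' : |z i k - anchorScale P i₀ z * ustar i k| ≤ P.δ n * P.b ^ P.K := by
        have h5 : (P.b ^ P.K)⁻¹ * |z i k - anchorScale P i₀ z * ustar i k| ≤ P.δ n :=
          (mul_le_mul_of_nonneg_right hG (abs_nonneg _)).trans hc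
        rw [inv_mul_le_iff₀ hbK'] at h5
        exact h5.trans_eq (mul_comm _ _)
      have hδn : P.δ n * P.b ^ P.K ≤ δbar * P.b ^ P.K := mul_le_mul_of_nonneg_right (hδ n) hbK'.le
      have hxu : |anchorScale P i₀ z * ustar i k| ≤ Mu := by
        rw [abs_mul, abs_of_nonneg hx0]
        have := mul_le_mul hx1 (hu i k hk) (abs_nonneg _) zero_le_one
        rwa [one_mul] at this
      have h4 := abs_sub_abs_le_abs_sub (z i k) (anchorScale P i₀ z * ustar i k)
      linarith

/-- **STATICS OF THE R54 TUBE FROM THE SCHEDULE** (`TubeStaticsWith` for `Bcl := behindR54 P θ′ Wb` discharged): signs and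
margins, weights `≥ 1`, and `TailFat` / `TameBehind` / `TailCompat` for `Z := tubeSetWith P (behindR54 P θ′ Wb) …` from the
weight algebra and the uniform schedule sups (`Wb n ≤ W̄`, `δ n ≤ δ̄`, `η n ≤ η̄`, bounded capture centres, `u⋆` bounded on
`k ≥ −K`), for the slow exponent `θ′ ≤ 2 log(1+ε₀)`. [cite: Tao2016AveragedNS, §6.2 Prop. 6.3 (ix), §6.3–6.4; cell LADDER §50, §54 (R54-1), §57.5 (L-57d)] -/
theorem tubeStaticsWith_R54_of_schedule {σ θ₀ θ c₀ c : ℝ} {env₀ : ℤ → ℝ}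
    (hr : 0 < r) (hθ0 : 0 ≤ θ₀) (hθθ : θ₀ < θ) (hθh : θ ≤ 1 / 2) (hc0 : 0 < c₀) (hc : c₀ < c) (hσ : 0 < σ)
    (hw : ∀ k, 1 ≤ w k) (hk₁ : 1 ≤ P.k₁)
    (hgrow : ∀ k : ℤ, (P.k₁ : ℤ) ≤ k → 2 * (1 + ε₀) ^ (k : ℝ) * w k ≤ w (k + 1))
    {K₀ C₄ : ℝ} (henv : ∀ k : ℤ, (P.k₁ : ℤ) ≤ k → env₀ k ≤ K₀ * r ^ 2 / w (k - 1) ^ 2)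
    (hC4 : ∀ k : ℤ, (P.k₁ : ℤ) ≤ k → (1 + ε₀) ^ ((5 : ℝ) * (k + 2) / 2) * r * w (k + 1) ≤ C₄ * w k ^ 2)
    {Cw : ℝ} (hwB : ∀ k : ℤ, k ≤ 0 → w k ≤ Cw * (1 + ε₀) ^ (-(k : ℝ)))
    (hg : 1 ≤ P.g) (hb : 1 ≤ P.b) (hAstar : 0 < P.Astar) (hε : 0 ≤ ε₀) (hθ2 : θ' ≤ 2 * Real.log (1 + ε₀))
    {Wbar δbar ηbar Mζ Mu : ℝ} (hWb : ∀ n, 0 ≤ Wb n ∧ Wb n ≤ Wbar) (hδ : ∀ n, P.δ n ≤ δbar) (hδ0 : 0 ≤ δbar)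
    (hη : ∀ n, P.η n ≤ ηbar) (hη0 : 0 ≤ ηbar) (hζ : ∀ n i k, |ζ n i k| ≤ Mζ)
    (hu : ∀ i k, -(P.K : ℤ) ≤ k → |ustar i k| ≤ Mu) (hMu : 0 ≤ Mu) :
    TubeStaticsWith P (behindR54 P θ' Wb) σ ε₀ i₀ X₀ w r θ₀ c₀ env₀ ζ ustar θ c := by
  have hw0 : ∀ k, 0 ≤ w k := fun k => zero_le_one.trans (hw k)
  have htail : ∀ k : ℤ, (P.k₁ : ℤ) ≤ k → ∀ z ∈ tubeSetWith P (behindR54 P θ' Wb) i₀ X₀ w r ζ ustar, ∀ i : Fin 2,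
      4 * (w k * |z i k|) ≤ r := by
    intro k hk z hz i
    obtain ⟨n, hn⟩ := hz
    exact tailClause_of_inTubeWith P hk₁ hw0 hr.le hn hk i
  refine ⟨hr, hθ0, hθθ, hθh, hc0, hc, hσ, hw, ?_, ?_, ?_⟩
  · exact ⟨P.k₁, fun k hk => ⟨hgrow k hk, htail k hk⟩⟩
  · refine ⟨max ((|X₀ 0| + |X₀ 1|) / |X₀ i₀| + (Mζ + ηbar) + (Mu + δbar * P.b ^ P.K) + Real.sqrt (2 * Wbar)) Cw,
      ?_, ?_⟩
    · intro z hz i k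
      obtain ⟨n, hn⟩ := hz
      have h := abs_le_of_inTubeR54 P hg hb hAstar hε hθ2 hWb hδ hδ0 hη hη0 hζ hu hMu hn i k
      have hpos : 0 ≤ 1 + (1 + ε₀) ^ (-(k : ℝ)) := by
        have := Real.rpow_pos_of_pos (by linarith : (0 : ℝ) < 1 + ε₀) (-(k : ℝ)); linarith
      exact h.trans (mul_le_mul_of_nonneg_right (le_max_left _ _) hpos)
    · intro k hk
      have hpos : 0 ≤ (1 + ε₀) ^ (-(k : ℝ)) := (Real.rpow_pos_of_pos (by linarith : (0 : ℝ) < 1 + ε₀) _).le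
      exact (hwB k hk).trans (mul_le_mul_of_nonneg_right (le_max_right _ _) hpos)
  · exact ⟨P.k₁, K₀, C₄, fun k hk => ⟨hgrow k hk, htail k hk, henv k hk, hC4 k hk⟩⟩

/-- **STATICS OF THE R54 TUBE WITH THE CONCRETE WEIGHT AND ENVELOPE**: `w := tubeWeight C b` (`C ≥ 1`, `b ≥ 1/2`,
`0 ≤ ε₀ ≤ 1`), `env₀ := tubeEnv P ε₀ K₀ r C b Eb`, `k₁ ≥ 1` past the thin-tail threshold (`hC4`), and the schedule sups.
[cite: Tao2016AveragedNS, §6.2 Prop. 6.3 (ix), §6.3–6.4; cell LADDER §50.9, §57.5 (L-57d)] -/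
theorem tubeStaticsWith_R54_tubeWeight {σ θ₀ θ c₀ c C b K₀ Eb C₄ : ℝ}
    (hε : 0 ≤ ε₀) (hε1 : ε₀ ≤ 1) (hC : 1 ≤ C) (hbw : 1 / 2 ≤ b)
    (hr : 0 < r) (hθ0 : 0 ≤ θ₀) (hθθ : θ₀ < θ) (hθh : θ ≤ 1 / 2) (hc0 : 0 < c₀) (hc : c₀ < c) (hσ : 0 < σ)
    (hk₁ : 1 ≤ P.k₁)
    (hC4 : ∀ k : ℤ, (P.k₁ : ℤ) ≤ k →
      (1 + ε₀) ^ ((5 : ℝ) * (k + 2) / 2) * r * tubeWeight C b (k + 1) ≤ C₄ * tubeWeight C b k ^ 2)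
    (hg : 1 ≤ P.g) (hb : 1 ≤ P.b) (hAstar : 0 < P.Astar) (hθ2 : θ' ≤ 2 * Real.log (1 + ε₀))
    {Wbar δbar ηbar Mζ Mu : ℝ} (hWb : ∀ n, 0 ≤ Wb n ∧ Wb n ≤ Wbar) (hδ : ∀ n, P.δ n ≤ δbar) (hδ0 : 0 ≤ δbar)
    (hη : ∀ n, P.η n ≤ ηbar) (hη0 : 0 ≤ ηbar) (hζ : ∀ n i k, |ζ n i k| ≤ Mζ)
    (hu : ∀ i k, -(P.K : ℤ) ≤ k → |ustar i k| ≤ Mu) (hMu : 0 ≤ Mu) :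
    TubeStaticsWith P (behindR54 P θ' Wb) σ ε₀ i₀ X₀ (tubeWeight C b) r θ₀ c₀ (tubeEnv P ε₀ K₀ r C b Eb) ζ ustar θ c := by
  have hC0 : 0 < C := by linarith
  refine tubeStaticsWith_R54_of_schedule (K₀ := K₀) (Cw := C) P hr hθ0 hθθ hθh hc0 hc hσ
    (one_le_tubeWeight hC (by linarith)) hk₁ ?_ ?_ hC4 ?_ hg hb hAstar hε hθ2 hWb hδ hδ0 hη hη0 hζ hu hMu
  · intro k hk
    exact tubeWeight_grow hε hε1 hC0 hbw k (by omega)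
  · intro k hk; exact (tubeEnv_of_le P ε₀ K₀ r C b Eb hk).le
  · intro k hk
    exact tubeWeight_behind hC0.le hε k hk

end R54Statics

end Summit.NavierStokesRegularity.NavierStokesRegularity.Theorems.HopTube

end
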